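import Mathlib.Analysis.SpecialFunctions.Trigonometric.Chebyshev.RootsExtrema
import Mathlib.Analysis.SpecialFunctions.Trigonometric.Chebyshev.Extremal
import Summits.Ventures.HSemireg.WedgeHankelRecurrenceGaussRatioMonotone

/-!
# Venture HSemireg — **CALIBRATION: THE CHEBYSHEV RECURRENCE `a ≡ 0`, `b_1 = 1∕2`, `b_j = 1∕4` (`j ≥ 2`)**: its monic polynomials are `q_n = 2^{1−n} T_n` (Mathlib's Chebyshev polynomials of the
# first kind), `q_n = ∏_k (X − cos((2(n−1−k)+1)π∕(2n)))` with the zeros listed increasingly, `|q_n| ≤ 2^{1−n}` on `[−1, 1]`, and every monic polynomial of degree `n` bounded by `M` on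
# `[−1, 1]` has `M ≥ 2^{1−n}` (Chebyshev's extremal theorem, from Mathlib)

HONEST FRAMING. Part of the Lean index of the computation cell `pub-hsemireg` (seat p10 gen 44, Sunday typer «UNIFORM-IN-n»).  Real polynomials and the real cosine only; the Chebyshev polynomials,
their trigonometric evaluation and extremal property are IMPORTED from Mathlib (`Polynomial.Chebyshev.T`, `T_real_cos`, `leadingCoeff_le_of_forall_abs_le_one`), not re-proved; no variety, no
cohomology theory, no sheaf, no Ext group and no semiregularity map is constructed here; nothing here says that HC / HC_CM / HC_AV holds; no Literature fact (unproved `Prop`) is declared or used.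
Custodian versions as in `WedgeHankelSiegelIdeal` (1/3).
SOURCES (cited).  P. L. Chebyshev, *Théorie des mécanismes connus sous le nom de parallélogrammes* (1854); G. Szegő, *Orthogonal Polynomials*, §1.12 (1.12.3), §2.4 (Jacobi case `α = β = −1∕2`),
(6.3.5) (zeros `cos((2ν−1)π∕2n)`); T. J. Rivlin, *Chebyshev Polynomials* (2nd ed. 1990) §1.2, Thm 2.1 (minimal sup norm of `2^{1−n}T_n`); T. S. Chihara, *An Introduction to Orthogonal Polynomials*,
Ch. I Ex. 4.3 (the monic recurrence with `λ_2 = 1∕2`, `λ_n = 1∕4`).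
PROOF TYPED HERE.  Two-step induction against Mathlib's `T_add_two`; the zeros from `T_real_cos` and `Real.cos_eq_zero_iff`, listed increasingly via `Fin.rev` and `Real.strictAntiOn_cos`,
assembled by N279 `eq_prod_X_sub_C_of_monic_of_roots`; the bounds from `abs_eval_T_real_le_one` and `leadingCoeff_le_of_forall_abs_le_one`.
DEDUP DISCLOSURE (`rg -n 'Chebyshev.T|T_real_cos' Summits/Ventures/HSemireg Literature`, 2026-09-03): the tree's HSemireg chapter never instantiates a concrete recurrence; Mathlib has the
Chebyshev polynomials, their roots (`roots_T_real`) and the extremal property — this leaf only CONNECTS the chapter's recurrence conventions to them.  The 6 names below: 0 hits tree-wide.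

WHAT IS IN THE TREE.  N279 `recurrence_monic_natDegree`, `eq_prod_X_sub_C_of_monic_of_roots`; Mathlib `Polynomial.Chebyshev.T_add_two`, `T_one`, `T_two`, `T_real_cos`,
`abs_eval_T_real_le_one`, `leadingCoeff_le_of_forall_abs_le_one`, `Real.strictAntiOn_cos`, `Real.cos_eq_zero_iff`.
THIS FILE (namespace `Summit.Ventures.HSemireg.Wedge.HankelOuter` continued; CHAINED on N331 (import only), N279; 0 definitions):
* §1097 **`chebyshev_recurrence_eq_T`** (`q_{n+1} = C((1∕2)^n)·T_{n+1}`), `chebyshev_nodes_strictMono` (`k ↦ cos((2(n−k)+1)π∕(2(n+1)))` is increasing on `Fin (n+1)`), `chebyshev_recurrence_eval_node`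
  (`q_{n+1}` vanishes there), **`chebyshev_recurrence_eq_prod`** (`q_{n+1} = ∏ (X − node_k)`), **`chebyshev_recurrence_abs_le`** (`|q_{n+1}(x)| ≤ (1∕2)^n` on `[−1,1]`),
  **`monic_sup_ge_chebyshev`** (a monic polynomial of degree `n + 1` bounded by `M` on `[−1,1]` has `(1∕2)^n ≤ M`).
CAVEATS.  The recurrence hypotheses are by value (`a n = 0`, `b 1 = 1∕2`, `b (n+2) = 1∕4`); the Favard weights (all equal) are not typed here.  Nothing Ext-side.  New names only.
-/

open Module Polynomial Real
open scoped Matrix Polynomial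

namespace Summit.Ventures.HSemireg.Wedge.HankelOuter

/-! ## §1097. The Chebyshev recurrence -/

/-- **`q_{n+1} = 2^{−n} T_{n+1}`** for the recurrence `a ≡ 0`, `b_1 = 1∕2`, `b_j = 1∕4` (`j ≥ 2`). [Szegő (1.12.3); Chihara Ch. I Ex. 4.3; this file, §1097] -/
theorem chebyshev_recurrence_eq_T {q : ℕ → ℝ[X]} {a b : ℕ → ℝ} (hq0 : q 0 = 1) (hq1 : q 1 = Polynomial.X - C (a 0))
    (hrec : ∀ n, q (n + 2) = (Polynomial.X - C (a (n + 1))) * q (n + 1) - C (b (n + 1)) * q n) (ha : ∀ n, a n = 0) (hb1 : b 1 = 1 / 2)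
    (hb : ∀ n, b (n + 2) = 1 / 4) : ∀ n : ℕ, q (n + 1) = C ((1 / 2 : ℝ) ^ n) * Polynomial.Chebyshev.T ℝ ((n : ℤ) + 1) := by
  -- `C(1/2)·2 = 1` and `C(1/4) = C(1/2)²` in `ℝ[X]`
  have h : C (1 / 2 : ℝ) * (2 : ℝ[X]) = 1 := by
    rw [show (2 : ℝ[X]) = C (2 : ℝ) from (map_ofNat C 2).symm, ← map_mul]; norm_num
  have hq : C (1 / 4 : ℝ) = C (1 / 2 : ℝ) ^ 2 := by rw [← map_pow]; norm_num
  have key : ∀ n : ℕ, q (n + 1) = C ((1 / 2 : ℝ) ^ n) * Polynomial.Chebyshev.T ℝ ((n : ℤ) + 1) ∧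
      q (n + 2) = C ((1 / 2 : ℝ) ^ (n + 1)) * Polynomial.Chebyshev.T ℝ ((n : ℤ) + 2) := by
    intro n
    induction n with
    | zero =>
      refine ⟨?_, ?_⟩
      · rw [hq1, ha 0, C_0, sub_zero, pow_zero, C_1, one_mul, Nat.cast_zero, zero_add, Polynomial.Chebyshev.T_one]
      · rw [hrec 0, hq1, hq0, ha 0, ha 1, hb1, C_0, sub_zero, mul_one, Nat.cast_zero, zero_add, zero_add, pow_one, Polynomial.Chebyshev.T_two]
        linear_combination (-(Polynomial.X ^ 2)) * h
    | succ n ih =>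
      obtain ⟨h1, h2⟩ := ih
      have h2' : q (n + 1 + 1) = C ((1 / 2 : ℝ) ^ (n + 1)) * Polynomial.Chebyshev.T ℝ ((n : ℤ) + 2) := h2
      have hb' : b (n + 1 + 1) = 1 / 4 := hb n
      refine ⟨by rw [h2']; push_cast; rw [show (n : ℤ) + 1 + 1 = (n : ℤ) + 2 by ring], ?_⟩
      have hT := Polynomial.Chebyshev.T_add_two (R := ℝ) ((n : ℤ) + 1)
      rw [show (n : ℤ) + 1 + 1 = (n : ℤ) + 2 by ring] at hT
      rw [hrec (n + 1), h2', h1, ha, hb', C_0, sub_zero]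
      push_cast
      rw [hT, hq]
      simp only [map_pow]
      linear_combination (-(Polynomial.X * Polynomial.Chebyshev.T ℝ ((n : ℤ) + 2) * C (1 / 2 : ℝ) ^ (n + 1))) * h
  exact fun n => (key n).1

/-- **The Chebyshev nodes listed increasingly: `k ↦ cos((2(n − k) + 1)π∕(2(n+1)))` is strictly increasing on `Fin (n+1)`** (`cos` is strictly decreasing on `[0, π]`). [Szegő (6.3.5); this file, §1097] -/
theorem chebyshev_nodes_strictMono (n : ℕ) :
    StrictMono (fun k : Fin (n + 1) => cos ((2 * ((Fin.rev k : Fin (n + 1)) : ℝ) + 1) * π / (2 * ((n : ℝ) + 1)))) := by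
  have hmem : ∀ k : Fin (n + 1), (2 * ((Fin.rev k : Fin (n + 1)) : ℝ) + 1) * π / (2 * ((n : ℝ) + 1)) ∈ Set.Icc 0 π := fun k => by
    have hk : ((Fin.rev k : Fin (n + 1)) : ℝ) ≤ n := by exact_mod_cast Nat.lt_succ_iff.1 (Fin.rev k).is_lt
    have hk0 : (0 : ℝ) ≤ ((Fin.rev k : Fin (n + 1)) : ℝ) := Nat.cast_nonneg _
    constructor
    · positivity
    · rw [div_le_iff₀ (by positivity)]; nlinarith [pi_pos]
  intro k l hkl
  refine strictAntiOn_cos (hmem l) (hmem k) ?_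
  have h : ((Fin.rev l : Fin (n + 1)) : ℝ) < ((Fin.rev k : Fin (n + 1)) : ℝ) := by exact_mod_cast Fin.rev_lt_rev.2 hkl
  exact div_lt_div_of_pos_right (by nlinarith [pi_pos]) (by positivity)

/-- **`q_{n+1}` vanishes at the Chebyshev nodes** (`T_{n+1}(cos θ) = cos((n+1)θ) = cos((2j+1)π∕2) = 0`). [this file, §1097] -/
theorem chebyshev_recurrence_eval_node {q : ℕ → ℝ[X]} {a b : ℕ → ℝ} (hq0 : q 0 = 1) (hq1 : q 1 = Polynomial.X - C (a 0))
    (hrec : ∀ n, q (n + 2) = (Polynomial.X - C (a (n + 1))) * q (n + 1) - C (b (n + 1)) * q n) (ha : ∀ n, a n = 0) (hb1 : b 1 = 1 / 2)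
    (hb : ∀ n, b (n + 2) = 1 / 4) (n : ℕ) (k : Fin (n + 1)) :
    (q (n + 1)).eval (cos ((2 * ((Fin.rev k : Fin (n + 1)) : ℝ) + 1) * π / (2 * ((n : ℝ) + 1)))) = 0 := by
  rw [chebyshev_recurrence_eq_T hq0 hq1 hrec ha hb1 hb n, eval_mul, eval_C, Polynomial.Chebyshev.T_real_cos, mul_eq_zero]
  right
  rw [Real.cos_eq_zero_iff]
  refine ⟨((Fin.rev k : Fin (n + 1)) : ℕ), ?_⟩
  push_cast
  field_simp

/-- **`q_{n+1} = ∏_k (X − cos((2(n − k) + 1)π∕(2(n+1))))`** — the zeros of the chapter's recurrence in its own (increasing, product) format. [Szegő (6.3.5); Mathlib `roots_T_real`; this file, §1097] -/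
theorem chebyshev_recurrence_eq_prod {q : ℕ → ℝ[X]} {a b : ℕ → ℝ} (hq0 : q 0 = 1) (hq1 : q 1 = Polynomial.X - C (a 0))
    (hrec : ∀ n, q (n + 2) = (Polynomial.X - C (a (n + 1))) * q (n + 1) - C (b (n + 1)) * q n) (ha : ∀ n, a n = 0) (hb1 : b 1 = 1 / 2)
    (hb : ∀ n, b (n + 2) = 1 / 4) (n : ℕ) :
    q (n + 1) = ∏ k : Fin (n + 1), (Polynomial.X - C (cos ((2 * ((Fin.rev k : Fin (n + 1)) : ℝ) + 1) * π / (2 * ((n : ℝ) + 1))))) := by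
  obtain ⟨hm, hd⟩ := recurrence_monic_natDegree hq0 hq1 hrec (n + 1)
  exact eq_prod_X_sub_C_of_monic_of_roots hm hd (chebyshev_nodes_strictMono n).injective (chebyshev_recurrence_eval_node hq0 hq1 hrec ha hb1 hb n)

/-- **`|q_{n+1}(x)| ≤ 2^{−n}` on `[−1, 1]`.** [Rivlin §1.2; Mathlib `abs_eval_T_real_le_one`; this file, §1097] -/
theorem chebyshev_recurrence_abs_le {q : ℕ → ℝ[X]} {a b : ℕ → ℝ} (hq0 : q 0 = 1) (hq1 : q 1 = Polynomial.X - C (a 0))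
    (hrec : ∀ n, q (n + 2) = (Polynomial.X - C (a (n + 1))) * q (n + 1) - C (b (n + 1)) * q n) (ha : ∀ n, a n = 0) (hb1 : b 1 = 1 / 2)
    (hb : ∀ n, b (n + 2) = 1 / 4) (n : ℕ) {x : ℝ} (hx : |x| ≤ 1) : |(q (n + 1)).eval x| ≤ (1 / 2 : ℝ) ^ n := by
  rw [chebyshev_recurrence_eq_T hq0 hq1 hrec ha hb1 hb n, eval_mul, eval_C, abs_mul, abs_of_pos (by positivity : (0 : ℝ) < (1 / 2) ^ n)]
  exact mul_le_of_le_one_right (by positivity) (Polynomial.Chebyshev.abs_eval_T_real_le_one _ hx)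

/-- **CHEBYSHEV'S EXTREMAL THEOREM (from Mathlib): a MONIC real polynomial of degree `n + 1` with `|Q| ≤ M` on `[−1, 1]` has `2^{−n} ≤ M`** — so `q_{n+1} = 2^{−n}T_{n+1}` has the least sup norm.
[Chebyshev 1854; Rivlin Thm 2.1; Mathlib `leadingCoeff_le_of_forall_abs_le_one`; this file, §1097] -/
theorem monic_sup_ge_chebyshev {n : ℕ} {Q : ℝ[X]} (hQm : Q.Monic) (hQd : Q.natDegree = n + 1) {M : ℝ} (hM : ∀ x ∈ Set.Icc (-1 : ℝ) 1, |Q.eval x| ≤ M) :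
    (1 / 2 : ℝ) ^ n ≤ M := by
  have hM0 : 0 < M := by
    have h1 := hM 1 ⟨by norm_num, le_rfl⟩
    rcases (abs_nonneg (Q.eval 1)).trans h1 |>.eq_or_lt with h | h
    · -- `M = 0` would force `Q` to vanish on `[−1, 1]`, impossible for a monic polynomial
      exfalso
      have hz : ∀ x ∈ Set.Icc (-1 : ℝ) 1, Q.eval x = 0 := fun x hx => abs_eq_zero.1 (le_antisymm (h ▸ hM x hx) (abs_nonneg _))
      have hinf : Set.Infinite {x : ℝ | Q.eval x = 0} := (Set.Icc_infinite (by norm_num : (-1 : ℝ) < 1)).mono fun x hx => hz x hx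
      exact hinf (Polynomial.finite_setOf_isRoot hQm.ne_zero)
    · exact h
  -- normalise: `P = M⁻¹ Q` is bounded by `1`, has degree `n + 1` and leading coefficient `M⁻¹`
  have hP := Polynomial.Chebyshev.leadingCoeff_le_of_forall_abs_le_one (n := n + 1) (P := C M⁻¹ * Q)
    (by rw [degree_C_mul (inv_ne_zero hM0.ne'), degree_eq_natDegree hQm.ne_zero, hQd])
    (fun x hx => by
      rw [eval_mul, eval_C, abs_mul, abs_of_pos (inv_pos.2 hM0)]
      exact (inv_mul_le_iff₀ hM0).2 (by rw [mul_one]; exact hM x hx))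
  rw [leadingCoeff_mul, leadingCoeff_C, hQm.leadingCoeff, mul_one, Nat.add_sub_cancel] at hP
  rw [show (1 / 2 : ℝ) ^ n = ((2 : ℝ) ^ n)⁻¹ by rw [one_div, inv_pow]]
  exact (inv_le_comm₀ hM0 (by positivity)).1 hP

end Summit.Ventures.HSemireg.Wedge.HankelOuter
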